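import Summits.ResolutionOfSingularities.ResolutionOfSingularities.Theses.Descent
import Literature.AlgebraicGeometry.CossartPiltant2008to2019.DimensionFourChain
import Literature.Barriers.ResolutionOfSingularities.DimensionFourFrontier
import Literature.AlgebraicGeometry.Resolution.AlterationsStrong

/-!
# Crux `DescentPerfectToAll` (stmt-ResolutionOfSingularities-0549) — lens 5 «transfer from the solved
sibling» (Cossart–Piltant 2019, dim ≤ 3, arbitrary fields): the LU-architecture census, typed

[OURS · CANDIDATE · counted 0 — nothing here proves resolution of singularities in characteristic `p`;
every theorem below is bookkeeping between typed predicates, proved by logic from tree declarations.]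
bears_on: LADDER-RESOLUTION:B. Unit `res-B-lens-5-g0` (planner), 2026-08-28. Companion memo:
`TRANSFER-CENSUS-lens5.md` (same directory).

QUESTION (KEY-res-B-descent, lens 5): is rung B — «resolution over PERFECT fields of char `p` ⟹
resolution over ALL fields of char `p`» — ABSORBED by an LU-shaped statement («local uniformization
for (quasi-)excellent regular local rings of dimension `n` with ARBITRARY residue field») that the
dimension-4 door (D-0157 DOOR 2, `Theorems/PurelyInseparableDim4Target.lean`) would feed?

TYPED ANSWER (this file):
* §1 `RungBUpToDim n` — the crux cut by dimension; `crux ↔ ∀ n, RungBUpToDim n`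
  (`descentPerfectToAll_iff_forall_rungBUpToDim`); `RungBUpToDim 3` is FREE from the sibling
  (`rungBUpToDim_three`, the tree's named fact `CossartPiltant2019`).
* §2 In Zariski's LU architecture the ANTECEDENT of the crux is exactly «LU over perfect fields, every
  dimension» (`lu_of_perfectRes`, valuative criterion) and the induction step of rung B is LOSSLESSLY
  «LU_n over IMPERFECT fields of char `p` ∧ Zariski patching_n over char-`p` fields»
  (`resCharUpToDim_iff_luImperfect_and_patching`): rung B is not absorbed by LU alone — patching in
  dimension `n ≥ 4` is the second, independent input (barrier `DimensionFourFrontier`).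
* §3 The Cossart–Piltant chain with `3 ↦ 4` (`DimensionFourChain`) gives `RungBUpToDim 4` WITHOUT
  USING THE ANTECEDENT (`rungBUpToDim_four_of_cpChain`; all `n`: `crux_of_cpChains`): in the sibling's
  architecture rung B is BYPASSED, not paid — its local theorem `LocalTheoremInDim n` already
  quantifies over regular local rings with arbitrary (imperfect) residue field. As a line for 0549 this
  is the dimension-`n` summit in costume (antecedent unused) and is NOT registered as a skeleton.
* §4 The residual LOCAL debt a perfect-residue-field door leaves, typed: `LocalTheoremInDimPerfectResidue n`
  (the local theorem at points with perfect residue field — what a `K`-rational / algebraically-closed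
  game such as `PIDim4.Terminates1h`/`OrderReduction` can at best deliver) and
  `LocalRungB n : LocalTheoremInDimPerfectResidue n → LocalTheoremInDim n` («local rung B»). In print the
  dimension-3 payment of `LocalRungB 3` is Cossart–Piltant 2019 Ch. 2 (invariants read off initial forms
  over `k(x)`, absolute `p`-bases, `ω` stable under regular base change — Thm. 2.8/Rem. 2.9 — but
  Hilbert–Samuel strata / directrix NOT stable, Prop. 2.15, Ex. 2.2, Ex. 3.3) plus `n = 3`-specific
  case analysis; no transferable lemma. [cite: CossartPiltant2019, Ch. 2 (arXiv v1 pp. 5, 13, 20, 24–26, 48)]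
  [cite: CossartPiltant2008, Thm. 7.2 ("with g ≠ 0 if k is perfect") and p. 1065 (k differentially finite)]
-/

set_option linter.dupNamespace false

noncomputable section

open CategoryTheory AlgebraicGeometry IsLocalRing Polynomial
open Literature.AlgebraicGeometry.Resolution Literature.Barriers.ResolutionOfSingularities
open Literature.AlgebraicGeometry.CossartPiltant2008to2019
open Summit.ResolutionOfSingularities.ResolutionOfSingularities.Theses.Descent (DescentPerfectToAll)

namespace Summit.ResolutionOfSingularities.ResolutionOfSingularities.Cruxes.DescentPerfectToAll.CpSibling

/-! ## §1 The crux cut by dimension -/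

/-- The antecedent of the crux at the prime `p`: resolution over PERFECT fields of characteristic `p`
(verbatim `Cruxes/DescentPerfectToAll/Disproof.lean`'s `PerfectRes`). -/
def PerfectRes (p : ℕ) : Prop :=
  ∀ (k : Type) [Field k] [CharP k p] [PerfectField k] (X : Scheme.{0}) (f : X ⟶ Spec (.of k)),
    IsSeparated f → LocallyOfFiniteType f → QuasiCompact f → IsReduced X → Scheme.HasResolution X

/-- Weak resolution up to dimension `n` over every field of characteristic `p`. -/
def ResCharUpToDim (p n : ℕ) : Prop :=
  ∀ (k : Type) [Field k] [CharP k p], ResolutionOverUpToDim.{0} k n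

/-- **Rung B up to dimension `n`**: resolution over perfect fields of char `p` (all dimensions) ⟹
resolution of reduced separated finite-type schemes of dimension `≤ n` over every field of char `p`. -/
def RungBUpToDim (n : ℕ) : Prop := ∀ p : ℕ, p.Prime → PerfectRes p → ResCharUpToDim p n

/-- Unfolding: the crux is «PerfectRes p → ResolutionInChar p» for every prime. [folklore] -/
theorem crux_iff : DescentPerfectToAll ↔ ∀ p : ℕ, p.Prime → PerfectRes p → ResolutionInChar.{0} p :=
  Iff.rfl

/-- The crux gives every dimension-cut. [folklore] -/
theorem rungBUpToDim_of_crux (h : DescentPerfectToAll) (n : ℕ) : RungBUpToDim n :=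
  fun p hp hP k _ _ => resolutionOverUpToDim_of_resolutionInChar (h p hp hP) k n

/-- `RungBUpToDim` is antitone in the dimension. [folklore] -/
theorem RungBUpToDim.mono {m n : ℕ} (hmn : m ≤ n) (h : RungBUpToDim n) : RungBUpToDim m :=
  fun p hp hP k _ _ => (h p hp hP k).mono hmn

/-- All dimension-cuts give the crux back: a quasi-compact scheme locally of finite type over a field is
finite-dimensional (`exists_topologicalKrullDim_le_of_locallyOfFiniteType`). [folklore] -/
theorem crux_of_forall_rungBUpToDim (h : ∀ n, RungBUpToDim n) : DescentPerfectToAll := by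
  intro p hp hP k _ _ X f hs hl hq hr
  haveI := hq; haveI := hl
  haveI : CompactSpace X := QuasiCompact.compactSpace_of_compactSpace f
  obtain ⟨d, hd⟩ := exists_topologicalKrullDim_le_of_locallyOfFiniteType f
  exact h d p hp hP k X f hs hl hq hr hd

/-- **The crux is the conjunction of its dimension-cuts.** [folklore] -/
theorem descentPerfectToAll_iff_forall_rungBUpToDim : DescentPerfectToAll ↔ ∀ n, RungBUpToDim n :=
  ⟨rungBUpToDim_of_crux, crux_of_forall_rungBUpToDim⟩

/-- **Dimension `≤ 3` of rung B is free from the sibling** (Cossart–Piltant 2019 prove resolution up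
to dimension `3` over EVERY field; the antecedent is not used). [cite: CossartPiltant2019, Thm. 1.1] -/
theorem rungBUpToDim_three (hCP : CossartPiltant2019.{0}) : RungBUpToDim 3 :=
  fun _ _ _ k _ _ => cossartPiltant2019_iff.mp hCP k

/-! ## §2 Rung B inside Zariski's LU architecture: antecedent = LU over perfect fields; the step is
LU over imperfect fields plus patching, losslessly -/

/-- **The antecedent, in LU form, is free**: resolution over perfect fields of char `p` gives local
uniformization in every dimension over every PERFECT field of char `p` (valuative criterion, the
barrier file's `LocalUniformizationUpToDim.of_resolution`). [folklore] -/
theorem lu_of_perfectRes {p : ℕ} (hP : PerfectRes p) (k : Type) [Field k] [CharP k p] [PerfectField k]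
    (n : ℕ) : LocalUniformizationUpToDim k n :=
  LocalUniformizationUpToDim.of_resolution fun X f hs hl hq hr _ => hP k X f hs hl hq hr

/-- Local uniformization up to dimension `n` over every IMPERFECT field of characteristic `p` — the
LU-shaped statement «LU for regular local rings essentially of finite type of dimension `≤ n` with
arbitrary residue field», ground-field form. -/
def LUImperfectUpToDim (p n : ℕ) : Prop :=
  ∀ (k : Type) [Field k] [CharP k p], ¬ PerfectField k → LocalUniformizationUpToDim k n

/-- Zariski patching in dimension `n` over fields of characteristic `p` only (the barrier's
`ZariskiPatchingUpToDim n` restricted to char `p`). -/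
def PatchingCharUpToDim (p n : ℕ) : Prop :=
  ∀ (k : Type) [Field k] [CharP k p],
    ResolutionOverUpToDim.{0} k (n - 1) → LocalUniformizationUpToDim k n → ResolutionOverUpToDim.{0} k n

/-- The all-fields patching of the barrier catalogue gives the char-`p` one. [folklore] -/
theorem patchingCharUpToDim_of_zariskiPatching {n : ℕ} (h : ZariskiPatchingUpToDim.{0} n) (p : ℕ) :
    PatchingCharUpToDim p n :=
  fun k _ _ => h k

/-- **Rung B's induction step in the LU architecture is lossless**: given the antecedent at `p` and
resolution up to dimension `n − 1` over all char-`p` fields, resolution up to dimension `n` over all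
char-`p` fields is EQUIVALENT to (LU_n over imperfect char-`p` fields) ∧ (patching_n over char-`p`
fields). So rung B|n is not absorbed by an LU statement alone: patching in dimension `n` (open for
`n ≥ 4`, `DimensionFourFrontier`) is the second input, and conversely every proof of rung B|n produces
LU_n over imperfect fields. [folklore] -/
theorem resCharUpToDim_iff_luImperfect_and_patching {p n : ℕ} (hP : PerfectRes p)
    (hprev : ResCharUpToDim p (n - 1)) :
    ResCharUpToDim p n ↔ LUImperfectUpToDim p n ∧ PatchingCharUpToDim p n := by
  refine ⟨fun h => ⟨fun k _ _ _ => LocalUniformizationUpToDim.of_resolution (h k), fun k _ _ _ _ => h k⟩,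
    fun ⟨hLU, hPatch⟩ k _ _ => ?_⟩
  by_cases hk : PerfectField k
  · exact hPatch k (hprev k) (lu_of_perfectRes hP k n)
  · exact hPatch k (hprev k) (hLU k hk)

/-- The same as an implication usable rung by rung: LU over imperfect fields and char-`p` patching in
dimension `n` carry rung B from dimension `n − 1` to dimension `n`. [folklore] -/
theorem rungBUpToDim_succ_of_lu_of_patching {n : ℕ} (hprev : RungBUpToDim (n - 1))
    (hLU : ∀ p : ℕ, p.Prime → PerfectRes p → LUImperfectUpToDim p n)
    (hPatch : ∀ p : ℕ, p.Prime → PatchingCharUpToDim p n) : RungBUpToDim n :=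
  fun p hp hP => (resCharUpToDim_iff_luImperfect_and_patching hP (hprev p hp hP)).mpr
    ⟨hLU p hp hP, hPatch p hp⟩

/-- **Rung B|4 from the two dimension-4 inputs of the frontier**, LU₄ asked over IMPERFECT char-`p`
fields only (the perfect ones are covered by the antecedent): this is the exact LU-shaped absorption —
`LUImperfectUpToDim p 4` together with `PatchingCharUpToDim p 4`. [cite: CossartPiltant2019, Thm. 1.1]
[cite: CutkoskyMourtada2019, §1] -/
theorem rungBUpToDim_four_of_luImperfect_of_patching (hCP : CossartPiltant2019.{0})
    (hLU : ∀ p : ℕ, p.Prime → PerfectRes p → LUImperfectUpToDim p 4)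
    (hPatch : ∀ p : ℕ, p.Prime → PatchingCharUpToDim p 4) : RungBUpToDim 4 :=
  rungBUpToDim_succ_of_lu_of_patching (n := 4) (rungBUpToDim_three hCP) hLU hPatch

/-- **Rung B rung by rung, losslessly**: given rung B up to dimension `n − 1`, rung B up to dimension `n`
is EQUIVALENT to «for every prime `p`, under the antecedent: LU_n over imperfect char-`p` fields and char-`p`
patching in dimension `n`». [folklore] -/
theorem rungBUpToDim_iff_lu_and_patching {n : ℕ} (hprev : RungBUpToDim (n - 1)) :
    RungBUpToDim n ↔
      ∀ p : ℕ, p.Prime → PerfectRes p → LUImperfectUpToDim p n ∧ PatchingCharUpToDim p n :=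
  ⟨fun h p hp hP => (resCharUpToDim_iff_luImperfect_and_patching hP (hprev p hp hP)).mp (h p hp hP),
    fun h p hp hP => (resCharUpToDim_iff_luImperfect_and_patching hP (hprev p hp hP)).mpr (h p hp hP)⟩

/-- **Rung B|4 is exactly LU₄-over-imperfect-fields plus char-`p` patching₄ (under the antecedent)**, over
the sibling's dimension-3 theorem: the precise sense in which an LU-shaped dimension-4 statement «absorbs»
rung B|4 — together with patching, never alone. [cite: CossartPiltant2019, Thm. 1.1]
[cite: CutkoskyMourtada2019, §1] -/
theorem rungBUpToDim_four_iff (hCP : CossartPiltant2019.{0}) :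
    RungBUpToDim 4 ↔
      ∀ p : ℕ, p.Prime → PerfectRes p → LUImperfectUpToDim p 4 ∧ PatchingCharUpToDim p 4 :=
  rungBUpToDim_iff_lu_and_patching (n := 4) (rungBUpToDim_three hCP)

/-! ## §3 The sibling's own architecture one dimension up BYPASSES rung B (antecedent unused) -/

/-- **Cossart–Piltant's chain with `3 ↦ 4` gives rung B|4 without the antecedent**: the local theorem
in ambient dimension `4` (for excellent regular local rings with ARBITRARY residue field), the
reduction, the descent from complete rings and Zariski patching in dimension `4` give resolution up to
dimension `4` over every field (`resolution_upToDim_four_of_chain`), hence `RungBUpToDim 4` with the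
hypothesis `PerfectRes p` DISCARDED. Typed record that in the sibling's architecture rung B is not a
step: it is the requirement that the local theorem be residue-field blind. NOT a line for 0549 (the
antecedent is unused: dimension-4 summit in costume). [cite: CossartPiltant2019, §1.1 and Ch. 4–5 (architecture)] -/
theorem rungBUpToDim_four_of_cpChain (h3 : CossartPiltant2019.{0}) (hH : Hironaka1964_local.{0})
    (hloc : LocalTheoremInDim.{0} 4) (hred : ReductionPInDim.{0} 4) (hdesc : LUOfCompleteInDim.{0} 4)
    (hP4 : ZariskiPatchingUpToDim.{0} 4) : RungBUpToDim 4 :=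
  fun _ _ _ k _ _ => resolution_upToDim_four_of_chain h3 hH hloc hred hdesc hP4 k

/-- **All dimensions**: the chains for every `n ≥ 3` (with resolution of surfaces and Hironaka's
characteristic-zero leaf) give the crux outright — again without its antecedent. [cite: CossartPiltant2019, §1.1 and Ch. 4–5 (architecture), with 3 ↦ n] -/
theorem crux_of_cpChains (hCJS : CossartJannsenSaito2020.{0}) (hH : Hironaka1964_local.{0})
    (hchain : ∀ n, 3 ≤ n → LocalTheoremInDim.{0} n ∧ ReductionPInDim.{0} n ∧
      LUOfCompleteInDim.{0} n ∧ ZariskiPatchingUpToDim.{0} n) : DescentPerfectToAll :=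
  crux_of_forall_rungBUpToDim fun n _ _ _ k _ _ => resolution_all_of_chains hCJS hH hchain k n

/-! ## §4 The residual LOCAL debt of a perfect-residue-field door, typed -/

/-- **The local theorem in ambient dimension `n` at points with PERFECT residue field** —
`LocalTheoremInDim n` (Cossart–Piltant journal Thm. 1.5 with `3 ↦ n`) restricted to excellent regular
local rings `S` whose residue field is perfect. This is the most a closed-point game over an
algebraically closed (or perfect) field with `K`-rational centres and CLEANING (deleting `q`-th-power
monomials `c·x^{qa}`, which is a coordinate change only when `c^{1/q} ∈ K`) can deliver: the frame
`PIDim4` (D-0157 DOOR 2) is of this kind. [cite: CossartPiltant2019, Thm. 1.5 (arXiv v1: Thm. 1.4), with 3 ↦ n, perfect residue field] -/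
def LocalTheoremInDimPerfectResidue (n : ℕ) : Prop :=
  ∀ (p : ℕ), p.Prime →
  ∀ (S : Type) [CommRing S] [IsDomain S] [IsRegularLocalRing S],
    IsExcellentRing S → ringKrullDim S = n → CharP (ResidueField S) p → PerfectField (ResidueField S) →
  ∀ (K : Type) [Field K] [Algebra S K] [IsFractionRing S K]
    (L : Type) [Field L] [Algebra K L] [Algebra S L] [IsScalarTower S K L]
    (h : S[X]) (x : L),
    h.Monic → h.natDegree = p → Irreducible (h.map (algebraMap S K)) → aeval x h = 0 →
    Algebra.adjoin K ({x} : Set L) = ⊤ →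
    ((CharP K p ∧ ∀ i, 0 < i → i < p → h.coeff i = 0) ∨
      (Nat.card (L ≃ₐ[K] L) = p ∧
        ∀ σ : L ≃ₐ[K] L, ∀ y ∈ Algebra.adjoin S ({x} : Set L),
          σ y ∈ Algebra.adjoin S ({x} : Set L))) →
  ∀ (O : ValuationSubring L), (∀ s : S, algebraMap S L s ∈ O) →
    (∀ s ∈ maximalIdeal S, O.valuation (algebraMap S L s) < 1) →
    ∃ (t : Finset L) (ht : (Algebra.adjoin S (insert x (t : Set L))).toSubring ≤ O.toSubring),
      IsRegularLocalRing (Localization.AtPrime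
        (Ideal.comap (Subring.inclusion ht) (maximalIdeal O)))

/-- The full local theorem gives the perfect-residue-field one. [folklore] -/
theorem localTheoremInDimPerfectResidue_of_localTheoremInDim {n : ℕ} (h : LocalTheoremInDim.{0} n) :
    LocalTheoremInDimPerfectResidue n :=
  fun p hp S _ _ _ hexc hdim hchar _ K _ _ _ L _ _ _ _ hh x hmon hdeg hirr hx hadj hcase O hS hm =>
    h p hp S hexc hdim hchar K L hh x hmon hdeg hirr hx hadj hcase O hS hm

/-- **«Local rung B» in ambient dimension `n`**: the local theorem at points with perfect residue
field ⟹ the local theorem at all points (imperfect residue fields `k(x)`, e.g. closed points with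
inseparable residue extension over an imperfect ground field, or over `𝔽_p((t))`). In dimension `3`
it is a theorem by Cossart–Piltant 2019 (both sides are), proved NOT by reduction to the perfect case
but by a residue-field-blind construction of the invariants (Ch. 2: initial forms over `k(x)`,
absolute `p`-bases, stability of `ω` under regular base change, Thm. 2.8 / Rem. 2.9; instability of
the Hilbert–Samuel stratum / directrix, Prop. 2.15, Ex. 2.2, Ex. 3.3). This — not `DescentPerfectToAll`
— is the statement a perfect-residue-field dimension-4 door leaves owing inside the LU architecture.
[cite: CossartPiltant2019, Ch. 2 (Thm. 2.8, Rem. 2.9, Prop. 2.15, Ex. 2.2) and Ex. 3.3 (arXiv v1 numbering)] -/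
def LocalRungB (n : ℕ) : Prop := LocalTheoremInDimPerfectResidue n → LocalTheoremInDim.{0} n

/-- Bookkeeping: a perfect-residue-field local theorem plus local rung B, the reduction, the descent
and patching in dimension `4` give rung B|4 (antecedent again unused). [folklore] -/
theorem rungBUpToDim_four_of_perfectResidue_of_localRungB (h3 : CossartPiltant2019.{0})
    (hH : Hironaka1964_local.{0}) (hperf : LocalTheoremInDimPerfectResidue 4) (hB : LocalRungB 4)
    (hred : ReductionPInDim.{0} 4) (hdesc : LUOfCompleteInDim.{0} 4) (hP4 : ZariskiPatchingUpToDim.{0} 4) :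
    RungBUpToDim 4 :=
  rungBUpToDim_four_of_cpChain h3 hH (hB hperf) hred hdesc hP4

end Summit.ResolutionOfSingularities.ResolutionOfSingularities.Cruxes.DescentPerfectToAll.CpSibling

end
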